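import Literature.NumberTheory.Transcendental.ManyCurveThetaOrbits
import Literature.NumberTheory.Transcendental.ManyCurveThetaMorphic
import Literature.NumberTheory.Transcendental.ThetaSplitSubgroups
import HarnessLib

/-!
# Split algebraic subgroups of the `k`-lattice standard models are cut out by theta forms

Topic `Literature/NumberTheory/Transcendental`; unit
`provefact-Literature.NumberTheory.Transcendental.H-0a3eb64689` (fact
`Literature.NumberTheory.Transcendental.HuberWustholzManyCurvePeriods`, `ManyCurvePeriods.lean`).
It introduces NO named fact. Lattice-family counterpart of the one-lattice
`ThetaSplitSubgroups.lean` together with the explicit forms of `ThetaSubgroupClassification.lean`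
(§ B3) it relies on, for the theta model of `ManyCurveTheta.lean` (lattice family
`L : 𝓙 → PeriodPair`, class map `cls : γ → 𝓙`, obstruction data `GaGmEFam.Std.SubgroupDataC`).

For a connected algebraic subgroup datum `K = (A, C, Ξ)` whose abelian part is SPLIT —
`C = span_ℚ {e_b : b ∈ S}` (`GaGmE.Std.coordSpan S`, reused) — the preimage
`exp⁻¹(G') = Lie G' + ker(exp)` (`GaGmEFam.Std.preimageSubgroup`) is the common zero set of the
explicit forms `splitForms` (binomial forms `GaGmE.Std.binomForm` of the integer characters of `A`,
pure coordinates `X_{(∅,(M,∅))}` with `M b = 0` for some `b ∈ S`, linear forms `GaGmE.Std.linForm`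
of `ξ ∈ Ξ` with `M ≡ 2` on `S`): `coe_preimageSubgroup_eq_zeroLocus_of_split`; in particular it is
`Θ`-definable (`thetaDefinable_preimageSubgroup_of_split`) and the closure `Z(𝔍(Lie G'))` in any
theta model lies in it (`zeroSet_vanishing_tangent_subset_of_split`). Also the values of the forms
(`thetaEval_binomForm`, `thetaEval_linForm`, …, block `b` computed with the lattice of its class)
and the automorphy `preimageSubgroup_subset_zeroLocus`. The proofs are those of the one-lattice
files verbatim, the lattice (points, `σ³`, `P₂(0) = -2`, `Z₂(0) = 0`) of block `b` being
`Λ_{cls b}`.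

## References

* Yu. V. Nesterenko, P. Philippon (eds.), *Introduction to Algebraic Independence Theory*,
  LNM 1752, Springer 2001, Ch. 11 (D. Roy), Thm. 4.1. [NesterenkoPhilippon2001]
* D. Bertrand, P. Philippon, *Sous-groupes algébriques de groupes algébriques commutatifs*,
  Illinois J. Math. 32 (1988), 263–280. [folklore]
* A. Huber, G. Wüstholz, *Transcendence and Linear Relations of 1-Periods*, Cambridge Tracts 227,
  CUP 2022, Thm. 15.3 (1). [HuberWustholz2022]
-/

noncomputable section

open Complex MvPolynomial
open scoped PeriodPair

namespace Literature.NumberTheory.Transcendental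

namespace GaGmEFam

namespace Std

open GaGmE (Kbar)
open GaGmE.Std (iy iz is coords coords_iy coords_iz coords_is yPart zPart sPart ThetaIdx thetaT thetaT_none
  thetaT_some univExtP_zero_eq_zero_iff binomForm isHomogeneous_binomForm linForm isHomogeneous_linForm
  coordSpan single_mem_coordSpan apply_eq_zero_of_mem_coordSpan apply_eq_zero_of_mem_span_coordSpan
  intRel mem_intRel_iff exists_int_shift_of_forall_exp_eq_one)

variable {𝓙 : Type} [DecidableEq 𝓙] {β γ δ : Type} [Fintype β] [Fintype γ] [Fintype δ] [DecidableEq γ]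
variable (L : 𝓙 → PeriodPair) (cls : γ → 𝓙) (κM : δ → γ → Kbar)

/-! ### Step B3: explicit equations for `Lie(hull) + ker` -/

omit [Fintype β] [Fintype δ] [DecidableEq γ] in
omit [DecidableEq 𝓙] in
/-- Some uncorrected product `∏_b P_{M b}(z'_b)` does not vanish at `w`. [folklore] -/
theorem exists_thetaPnone_ne_zero (w : β ⊕ (γ ⊕ δ) → ℂ) :
    ∃ Mc : γ → Fin 3, thetaPnone (β := β) (δ := δ) L cls Mc w ≠ 0 := by
  classical
  let Mc : γ → Fin 3 := fun b => if w (iz b) ∈ (L (cls b)).lattice then 2 else 0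
  have hM : ∀ b, (L (cls b)).univExtP (Mc b) (w (iz b)) ≠ 0 := by
    intro b
    by_cases hb : w (iz b) ∈ (L (cls b)).lattice
    · obtain ⟨m', n', hmn⟩ := PeriodPair.mem_lattice.mp hb
      obtain ⟨c, hc, -, -, h2, -⟩ := (L (cls b)).exists_univExtTheta_lattice m' n' 0
      simp only [PeriodPair.univExtTheta_inl] at h2
      have : Mc b = 2 := if_pos hb
      rw [this, ← hmn, h2]
      exact mul_ne_zero hc (by norm_num)
    · have : Mc b = 0 := if_neg hb
      rw [this, (PeriodPair.univExtP_eq hb).1]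
      exact pow_ne_zero _ ((L (cls b)).weierstrassSigma_ne_zero hb)
  exact ⟨Mc, Finset.prod_ne_zero_iff.mpr fun b _ => hM b⟩

omit [Fintype β] [Fintype δ] in
omit [DecidableEq 𝓙] in
/-- `F_{X_{(none,(0,none))}}(x) = ∏_b P₀(z'_b(x))`. [folklore] -/
theorem thetaEval_X_zero (x : β ⊕ (γ ⊕ δ) → ℂ) :
    thetaEval L cls κM (X (none, ((fun _ => 0 : γ → Fin 3), none))) x = ∏ b, (L (cls b)).univExtP 0 (x (iz b)) := by
  rw [thetaEval_X]
  simp [theta, thetaPnone]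

omit [Fintype β] [Fintype δ] in
omit [DecidableEq 𝓙] in
/-- `F_{P - Q} = F_P - F_Q`. [folklore] -/
theorem thetaEval_sub (P Q : MvPolynomial (Option β × ThetaIdx γ δ) ℂ) (w : β ⊕ (γ ⊕ δ) → ℂ) :
    thetaEval L cls κM (P - Q) w = thetaEval L cls κM P w - thetaEval L cls κM Q w := by
  simp [thetaEval]

omit [Fintype β] [Fintype δ] in
omit [DecidableEq 𝓙] in
/-- `F_{X_J^k} = Θ_J^k`. [folklore] -/
theorem thetaEval_X_pow (J : Option β × ThetaIdx γ δ) (k : ℕ) (w : β ⊕ (γ ⊕ δ) → ℂ) :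
    thetaEval L cls κM (X J ^ k) w = theta L cls κM J w ^ k := by
  simp [thetaEval]

omit [Fintype δ] in
omit [DecidableEq 𝓙] in
/-- Products of powers of the torus coordinates over a fixed `P_κ`-index:
`F_{∏_j X_{(some j, I)}^{a_j}}(x) = e^{∑ a_j y'_j} Θ^P_I(x)^{∑ a_j}`. [folklore] -/
theorem thetaEval_prod_X_some_pow (I : ThetaIdx γ δ) (a : β → ℕ) (x : β ⊕ (γ ⊕ δ) → ℂ) :
    thetaEval L cls κM (∏ j, X (some j, I) ^ a j) x =
      cexp (∑ j, (a j : ℂ) * x (iy j)) * thetaP L cls κM I x ^ (∑ j, a j) := by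
  simp only [thetaEval, map_prod, map_pow, eval_X, theta, thetaT_some, mul_pow,
    Finset.prod_mul_distrib, Finset.prod_pow_eq_pow_sum, exp_sum]
  congr 1
  refine Finset.prod_congr rfl fun j _ => ?_
  rw [← exp_nat_mul]

omit [Fintype δ] in
omit [DecidableEq 𝓙] in
/-- **Values of the binomial form**:
`F(x) = Θ^P_I(x)^{|q⁺|+|q⁻|} · e^{⟨q⁻, y'⟩} · (e^{⟨q, y'⟩} - 1)`. [folklore] -/
theorem thetaEval_binomForm (q : β → ℤ) (I : ThetaIdx γ δ) (x : β ⊕ (γ ⊕ δ) → ℂ) :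
    thetaEval L cls κM (binomForm q I) x =
      thetaP L cls κM I x ^ (∑ j, (q j).toNat + ∑ j, (-q j).toNat) *
        cexp (∑ j, ((-q j).toNat : ℂ) * x (iy j)) * (cexp (∑ j, (q j : ℂ) * x (iy j)) - 1) := by
  have hq : ∀ j, ((q j).toNat : ℂ) = (q j : ℂ) + ((-q j).toNat : ℂ) := by
    intro j
    have h := Int.toNat_sub_toNat_neg (q j)
    have h' : ((q j).toNat : ℤ) = q j + ((-q j).toNat : ℤ) := by omega
    exact_mod_cast congrArg (fun z : ℤ => (z : ℂ)) h'
  have hexp : cexp (∑ j, ((q j).toNat : ℂ) * x (iy j)) =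
      cexp (∑ j, (q j : ℂ) * x (iy j)) * cexp (∑ j, ((-q j).toNat : ℂ) * x (iy j)) := by
    rw [← exp_add, ← Finset.sum_add_distrib]
    congr 1
    refine Finset.sum_congr rfl fun j _ => ?_
    rw [hq j]; ring
  unfold binomForm
  rw [thetaEval_sub, thetaEval_mul, thetaEval_mul, thetaEval_prod_X_some_pow, thetaEval_prod_X_some_pow,
    thetaEval_X_pow, thetaEval_X_pow]
  simp only [theta, thetaT_none, one_mul]
  rw [hexp]
  ring

omit [Fintype β] in
omit [DecidableEq 𝓙] in
/-- **Values of the linear forms**: `F(x) = ⟨ξ, s(x)⟩ ∏_b P_{M b}(z'_b) -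
∑_b ⟨ξ, κ_{·b}⟩ Z_{M b}(z'_b) ∏_{b' ≠ b} P_{M b'}(z'_{b'})`. [folklore] -/
theorem thetaEval_linForm (ξ : δ → ℂ) (Mc : γ → Fin 3) (x : β ⊕ (γ ⊕ δ) → ℂ) :
    thetaEval L cls κM (linForm ξ Mc) x =
      (∑ e, ξ e * x (is e)) * thetaPnone (β := β) (δ := δ) L cls Mc x -
        ∑ b, (∑ e, ξ e * (κM e b : ℂ)) * ((L (cls b)).univExtZ (Mc b) (x (iz b)) *
          ∏ b' ∈ Finset.univ.erase b, (L (cls b')).univExtP (Mc b') (x (iz b'))) := by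
  unfold linForm
  simp only [thetaEval, map_sum, map_mul, eval_C, eval_X, theta, thetaT_none, one_mul, thetaP_some,
    thetaPsome]
  simp only [mul_sub, Finset.sum_sub_distrib, Finset.sum_mul, Finset.mul_sum]
  congr 1
  · exact Finset.sum_congr rfl fun e _ => by ring
  · rw [Finset.sum_comm]
    exact Finset.sum_congr rfl fun b _ => Finset.sum_congr rfl fun e _ => by ring

omit [Fintype β] in
omit [DecidableEq 𝓙] in
/-- On `z' = 0` the linear form with `M ≡ 2` is `(-2)^{|γ|} ⟨ξ, s⟩` (`P₂(0) = -2`, `Z₂(0) = 0`).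
[folklore] -/
theorem thetaEval_linForm_two_of_z_eq_zero (ξ : δ → ℂ) {x : β ⊕ (γ ⊕ δ) → ℂ} (hx : ∀ b, x (iz b) = 0) :
    thetaEval L cls κM (linForm ξ (fun _ => (2 : Fin 3))) x = (∑ e, ξ e * x (is e)) * (-2) ^ Fintype.card γ := by
  rw [thetaEval_linForm]
  have hZ : ∀ b, (L (cls b)).univExtZ 2 (x (iz b)) = 0 := fun b => by rw [hx b]; exact (L (cls b)).univExtZ_at_zero.2.2
  have hP : ∀ b, (L (cls b)).univExtP 2 (x (iz b)) = -2 := fun b => by rw [hx b]; exact (L (cls b)).univExtP_at_zero.2.2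
  simp only [hZ, zero_mul, mul_zero, Finset.sum_const_zero, sub_zero, thetaPnone, hP,
    Finset.prod_const, Finset.card_univ]

omit [Fintype β] in
omit [DecidableEq 𝓙] in
/-- When `⟨ξ, κ_{·b}⟩ = 0` for all `b`, the linear form is `⟨ξ, s⟩ ∏_b P_{M b}(z'_b)`. [folklore] -/
theorem thetaEval_linForm_of_perp (ξ : δ → ℂ) (Mc : γ → Fin 3) (hκ : ∀ b, ∑ e, ξ e * (κM e b : ℂ) = 0)
    (x : β ⊕ (γ ⊕ δ) → ℂ) :
    thetaEval L cls κM (linForm ξ Mc) x = (∑ e, ξ e * x (is e)) * thetaPnone (β := β) (δ := δ) L cls Mc x := by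
  rw [thetaEval_linForm]
  simp [hκ]

omit [Fintype β] [Fintype δ] [DecidableEq γ] in
omit [DecidableEq 𝓙] in
/-- The torus kernel vector `(2πi m; 0; 0) ∈ ker(exp_{M_κ})`. [folklore] -/
theorem coords_two_pi_I_mem_ker (mm : β → ℤ) :
    coords (fun j => 2 * Real.pi * I * (mm j : ℂ)) (0 : γ → ℂ) (0 : δ → ℂ) ∈ ker L cls κM :=
  ⟨fun j => ⟨mm j, by simp; ring⟩, 0, 0, fun b => by simp, fun e => by simp⟩


/-! ### The zero locus of forms vanishing on `Lie G'` contains the whole preimage -/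

/-- **Automorphy**: the zero locus of a set of forms is a union of `ker(exp)`-orbits, so it contains
`Lie G' + ker` as soon as it contains `Lie G'`. [folklore] -/
theorem preimageSubgroup_subset_zeroLocus {Ps : Set (MvPolynomial (Option β × ThetaIdx γ δ) ℂ)}
    (hPs : ∀ P ∈ Ps, ∃ d, P.IsHomogeneous d) (K : SubgroupDataC β γ δ cls κM)
    (hvan : ∀ P ∈ Ps, ∀ t ∈ K.tangent, thetaEval L cls κM P t = 0) :
    (preimageSubgroup L cls κM K : Set (β ⊕ (γ ⊕ δ) → ℂ)) ⊆ {w | ∀ P ∈ Ps, thetaEval L cls κM P w = 0} := by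
  intro w hw
  obtain ⟨t, ht, k, hk, rfl⟩ := AddSubgroup.mem_sup.mp hw
  -- the zero locus is invariant under the group generated by `ker`
  have key : ∀ k ∈ AddSubgroup.closure (ker L cls κM), ∀ x : β ⊕ (γ ⊕ δ) → ℂ,
      (∀ P ∈ Ps, thetaEval L cls κM P (x + k) = 0) ↔ (∀ P ∈ Ps, thetaEval L cls κM P x = 0) := by
    intro k hk
    induction hk using AddSubgroup.closure_induction with
    | mem k hk =>
      intro x
      refine forall₂_congr fun P hP => ?_
      obtain ⟨d, hd⟩ := hPs P hP
      exact thetaEval_add_ker_eq_zero_iff L cls κM hd hk x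
    | zero => intro x; simp
    | add k₁ k₂ _ _ h₁ h₂ =>
      intro x
      rw [← add_assoc, h₂ (x + k₁), h₁ x]
    | neg k _ h =>
      intro x
      have := h (x + -k)
      rw [neg_add_cancel_right] at this
      exact this.symm
  exact (key k hk t).mpr fun P hP => hvan P hP t ht

/-! ### The forms of a split datum -/

/-- **The forms cutting out a split algebraic subgroup** (module docstring). [folklore] -/
def splitForms (K : SubgroupDataC β γ δ cls κM) (S : Finset γ) : Set (MvPolynomial (Option β × ThetaIdx γ δ) ℂ) :=
  {P | ∃ (q : β → ℤ) (M : γ → Fin 3), q ∈ intRel K.A ∧ P = binomForm q (M, none)} ∪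
    {P | ∃ M : γ → Fin 3, (∃ b ∈ S, M b = 0) ∧ P = X (none, (M, none))} ∪
    {P | ∃ (ξ : δ → ℂ) (M : γ → Fin 3), ξ ∈ K.Ξ ∧ (∀ b ∈ S, M b = 2) ∧ P = linForm ξ M}

omit [DecidableEq γ] in
/-- The split forms are forms. [folklore] -/
theorem exists_isHomogeneous_of_mem_splitForms {K : SubgroupDataC β γ δ cls κM} {S : Finset γ}
    {P : MvPolynomial (Option β × ThetaIdx γ δ) ℂ} (hP : P ∈ splitForms cls κM K S) : ∃ d, P.IsHomogeneous d := by
  rcases hP with (⟨q, M, -, rfl⟩ | ⟨M, -, rfl⟩) | ⟨ξ, M, -, -, rfl⟩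
  · exact ⟨_, isHomogeneous_binomForm q (M, none)⟩
  · exact ⟨1, isHomogeneous_X ℂ _⟩
  · exact ⟨1, isHomogeneous_linForm ξ M⟩

/-- **The split forms vanish on `Lie G'`.** [folklore] -/
theorem thetaEval_eq_zero_of_mem_splitForms {K : SubgroupDataC β γ δ cls κM} {S : Finset γ}
    (hC : K.C = coordSpan S) {P : MvPolynomial (Option β × ThetaIdx γ δ) ℂ} (hP : P ∈ splitForms cls κM K S)
    {t : β ⊕ (γ ⊕ δ) → ℂ} (ht : t ∈ K.tangent) : thetaEval L cls κM P t = 0 := by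
  obtain ⟨hA, hCt, hΞ⟩ := (K.mem_tangent_iff t).mp ht
  have hsum : ∀ b, ∑ x, (((Pi.single b (1 : ℚ) : γ → ℚ) x : ℚ) : ℂ) * t (iz x) = t (iz b) := by
    intro b
    rw [Finset.sum_eq_single b (fun x _ hx => by simp [hx]) (fun h => absurd (Finset.mem_univ b) h)]
    simp
  have hzS : ∀ b ∈ S, t (iz b) = 0 := by
    intro b hb
    have h := hCt _ (hC ▸ single_mem_coordSpan hb)
    rwa [hsum] at h
  rcases hP with (⟨q, M, hq, rfl⟩ | ⟨M, ⟨b, hb, hMb⟩, rfl⟩) | ⟨ξ, M, hξ, hM2, rfl⟩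
  · -- binomial: `⟨q, y'(t)⟩ = 0`
    have h0 : ∑ j, (q j : ℂ) * t (iy j) = 0 := by
      have := hA _ (mem_intRel_iff.mp hq)
      simpa using this
    rw [thetaEval_binomForm, h0, exp_zero, sub_self, mul_zero]
  · -- pure coordinate with `M b = 0`, `b ∈ S`: `σ(0)³ = 0`
    rw [thetaEval_X, theta, thetaT_none, one_mul, thetaP_none]
    refine Finset.prod_eq_zero (Finset.mem_univ b) ?_
    rw [hMb, hzS b hb]
    exact (L (cls b)).univExtP_at_zero.1
  · -- linear form
    rw [thetaEval_linForm]
    have hs : ∑ e, ξ e * t (is e) = 0 := hΞ ξ hξ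
    rw [hs, zero_mul, zero_sub, neg_eq_zero]
    refine Finset.sum_eq_zero fun b _ => ?_
    by_cases hb : b ∈ S
    · rw [hM2 b hb, hzS b hb, (L (cls b)).univExtZ_at_zero.2.2]; ring
    · have hκ : (∑ e, ξ e * (κM e b : ℂ)) = 0 := by
        have := K.compat ξ hξ
        rw [hC] at this
        exact apply_eq_zero_of_mem_span_coordSpan this hb
      rw [hκ, zero_mul]

/-! ### The zero locus of the split forms is the preimage -/

/-- **A common zero of the split forms lies in `Lie G' + ker`.** [folklore] -/
theorem mem_preimageSubgroup_of_forall_splitForms {K : SubgroupDataC β γ δ cls κM} {S : Finset γ}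
    (hC : K.C = coordSpan S) {w : β ⊕ (γ ⊕ δ) → ℂ}
    (hw : ∀ P ∈ splitForms cls κM K S, thetaEval L cls κM P w = 0) : w ∈ preimageSubgroup L cls κM K := by
  classical
  obtain ⟨Mc, hMc⟩ := exists_thetaPnone_ne_zero (β := β) (δ := δ) L cls w
  have hMcb : ∀ b, (L (cls b)).univExtP (Mc b) (w (iz b)) ≠ 0 := fun b =>
    (Finset.prod_ne_zero_iff.mp hMc) b (Finset.mem_univ b)
  -- (Y) torus: the integer characters of `A` are trivial at `y'(w)`
  have hY : ∀ q : β → ℤ, (fun j => (q j : ℚ)) ∈ K.A → cexp (∑ j, (q j : ℂ) * w (iy j)) = 1 := by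
    intro q hq
    by_contra hne
    have := hw _ (Or.inl (Or.inl ⟨q, Mc, mem_intRel_iff.mpr hq, rfl⟩))
    rw [thetaEval_binomForm, thetaP_none] at this
    rcases mul_eq_zero.mp this with h | h
    · rcases mul_eq_zero.mp h with h | h
      · exact hMc (pow_eq_zero_iff'.mp h).1
      · exact exp_ne_zero _ h
    · exact hne (sub_eq_zero.mp h)
  obtain ⟨mm, hmm⟩ := exists_int_shift_of_forall_exp_eq_one K.A (fun j => w (iy j)) hY
  -- (E) the `E`-coordinates in `S` are lattice points
  have hzΛ : ∀ b ∈ S, w (iz b) ∈ (L (cls b)).lattice := by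
    intro b hb
    have := hw _ (Or.inl (Or.inr ⟨Function.update Mc b 0, ⟨b, hb, Function.update_self _ _ _⟩, rfl⟩))
    rw [thetaEval_X, theta, thetaT_none, one_mul, thetaP_none, thetaPnone_update] at this
    rcases mul_eq_zero.mp this with h | h
    · exact (univExtP_zero_eq_zero_iff (L (cls b)) _).mp h
    · obtain ⟨b', hb', h0⟩ := Finset.prod_eq_zero_iff.mp h
      exact absurd h0 (hMcb b')
  have hmn' : ∀ b, ∃ m n : ℤ, b ∈ S → (m : ℂ) * (L (cls b)).ω₁ + n * (L (cls b)).ω₂ = w (iz b) := by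
    intro b
    by_cases hb : b ∈ S
    · obtain ⟨m, n, h⟩ := PeriodPair.mem_lattice.mp (hzΛ b hb)
      exact ⟨m, n, fun _ => h⟩
    · exact ⟨0, 0, fun h => absurd h hb⟩
  choose m₀ n₀ hmn₀ using hmn'
  let m : γ → ℤ := fun b => if b ∈ S then m₀ b else 0
  let n : γ → ℤ := fun b => if b ∈ S then n₀ b else 0
  have hmnS : ∀ b ∈ S, (m b : ℂ) * (L (cls b)).ω₁ + (n b : ℂ) * (L (cls b)).ω₂ = w (iz b) := by
    intro b hb; simp only [m, n, if_pos hb]; exact hmn₀ b hb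
  have hmn0 : ∀ b, b ∉ S → (m b : ℂ) * (L (cls b)).ω₁ + (n b : ℂ) * (L (cls b)).ω₂ = 0 := by
    intro b hb; simp [m, n, if_neg hb]
  set k₀ : β ⊕ (γ ⊕ δ) → ℂ := coords (0 : β → ℂ) (fun b => (m b : ℂ) * (L (cls b)).ω₁ + (n b : ℂ) * (L (cls b)).ω₂)
    (fun e => ∑ b, (κM e b : ℂ) * ((m b : ℂ) * (L (cls b)).η₁ + (n b : ℂ) * (L (cls b)).η₂)) with hk₀
  have hk₀mem : k₀ ∈ ker L cls κM := coords_lattice_mem_ker L cls κM m n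
  set x : β ⊕ (γ ⊕ δ) → ℂ := w - k₀ with hx
  have hwx : w = x + k₀ := by rw [hx, sub_add_cancel]
  have hxzS : ∀ b ∈ S, x (iz b) = 0 := by
    intro b hb; simp [hx, hk₀, hmnS b hb]
  have hxz : ∀ b, b ∉ S → x (iz b) = w (iz b) := by
    intro b hb; simp [hx, hk₀, hmn0 b hb]
  -- (S) the fibre conditions at `x`
  set Mc' : γ → Fin 3 := fun b => if b ∈ S then 2 else Mc b with hMc'
  have hPx : thetaPnone (β := β) (δ := δ) L cls Mc' x ≠ 0 := by
    refine Finset.prod_ne_zero_iff.mpr fun b _ => ?_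
    by_cases hb : b ∈ S
    · simp only [hMc', if_pos hb, hxzS b hb, (L (cls b)).univExtP_at_zero.2.2]; norm_num
    · simp only [hMc', if_neg hb, hxz b hb]; exact hMcb b
  have hΞ : ∀ ξ ∈ K.Ξ, ∑ e, ξ e * x (is e) = 0 := by
    intro ξ hξ
    have h1 := hw _ (Or.inr ⟨ξ, Mc', hξ, fun b hb => by simp [hMc', hb], rfl⟩)
    rw [hwx, thetaEval_add_ker_eq_zero_iff L cls κM (isHomogeneous_linForm ξ _) hk₀mem, thetaEval_linForm] at h1
    have hsum : ∑ b, (∑ e, ξ e * (κM e b : ℂ)) * ((L (cls b)).univExtZ (Mc' b) (x (iz b)) *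
        ∏ b' ∈ Finset.univ.erase b, (L (cls b')).univExtP (Mc' b') (x (iz b'))) = 0 := by
      refine Finset.sum_eq_zero fun b _ => ?_
      by_cases hb : b ∈ S
      · have : Mc' b = 2 := by simp [hMc', hb]
        rw [this, hxzS b hb, (L (cls b)).univExtZ_at_zero.2.2]; ring
      · have hκ : (∑ e, ξ e * (κM e b : ℂ)) = 0 := by
          have := K.compat ξ hξ
          rw [hC] at this
          exact apply_eq_zero_of_mem_span_coordSpan this hb
        rw [hκ, zero_mul]
    rw [hsum, sub_zero] at h1
    exact (mul_eq_zero.mp h1).resolve_right hPx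
  -- assemble: `w = t + (2πi mm; 0; 0) + k₀` with `t ∈ Lie G'`
  set y₁ : β → ℂ := fun j => w (iy j) - 2 * Real.pi * I * (mm j) with hy₁
  set t : β ⊕ (γ ⊕ δ) → ℂ := coords y₁ (zPart x) (sPart x) with ht
  have htmem : t ∈ K.tangent := by
    rw [K.mem_tangent_iff]
    refine ⟨fun q hq => by simpa [ht] using hmm q hq, fun c hc => ?_, fun ξ hξ => by simpa [ht, sPart] using hΞ ξ hξ⟩
    simp only [ht, coords_iz, zPart]
    refine Finset.sum_eq_zero fun b _ => ?_
    by_cases hb : b ∈ S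
    · rw [hxzS b hb, mul_zero]
    · rw [hC] at hc
      rw [apply_eq_zero_of_mem_coordSpan hc hb, Rat.cast_zero, zero_mul]
  have hkT : coords (fun j => 2 * Real.pi * I * (mm j : ℂ)) (0 : γ → ℂ) (0 : δ → ℂ) ∈
      AddSubgroup.closure (ker L cls κM) := AddSubgroup.subset_closure (coords_two_pi_I_mem_ker L cls κM mm)
  have hxt : x = t + coords (fun j => 2 * Real.pi * I * (mm j : ℂ)) (0 : γ → ℂ) (0 : δ → ℂ) := by
    funext i
    rcases i with j | b | e
    · show x (iy j) = t (iy j) + coords (fun j => 2 * Real.pi * I * (mm j : ℂ)) (0 : γ → ℂ) (0 : δ → ℂ) (iy j)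
      simp only [hx, ht, hk₀, hy₁, Pi.sub_apply, coords_iy, Pi.zero_apply]
      ring
    · show x (iz b) = t (iz b) + coords (fun j => 2 * Real.pi * I * (mm j : ℂ)) (0 : γ → ℂ) (0 : δ → ℂ) (iz b)
      simp only [ht, coords_iz, zPart, Pi.zero_apply, add_zero]
    · show x (is e) = t (is e) + coords (fun j => 2 * Real.pi * I * (mm j : ℂ)) (0 : γ → ℂ) (0 : δ → ℂ) (is e)
      simp only [ht, coords_is, sPart, Pi.zero_apply, add_zero]
  rw [hwx, hxt, add_assoc]
  exact AddSubgroup.add_mem _ (AddSubgroup.mem_sup_left htmem)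
    (AddSubgroup.mem_sup_right (AddSubgroup.add_mem _ hkT (AddSubgroup.subset_closure hk₀mem)))

/-- **The preimage `exp⁻¹(G')` of a split algebraic subgroup is the common zero set of the split
forms.** [folklore] -/
theorem coe_preimageSubgroup_eq_zeroLocus_of_split (K : SubgroupDataC β γ δ cls κM) (S : Finset γ)
    (hC : K.C = coordSpan S) :
    (preimageSubgroup L cls κM K : Set (β ⊕ (γ ⊕ δ) → ℂ)) = {w | ∀ P ∈ splitForms cls κM K S, thetaEval L cls κM P w = 0} :=
  Set.Subset.antisymm
    (preimageSubgroup_subset_zeroLocus L cls κM (fun _ hP => exists_isHomogeneous_of_mem_splitForms cls κM hP) K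
      fun _ hP _ ht => thetaEval_eq_zero_of_mem_splitForms L cls κM hC hP ht)
    fun _ hw => mem_preimageSubgroup_of_forall_splitForms L cls κM hC hw

/-- **The preimage of a split algebraic subgroup is `Θ`-definable.** [folklore] -/
theorem thetaDefinable_preimageSubgroup_of_split (K : SubgroupDataC β γ δ cls κM) (S : Finset γ)
    (hC : K.C = coordSpan S) :
    ThetaDefinable L cls κM (preimageSubgroup L cls κM K : Set (β ⊕ (γ ⊕ δ) → ℂ)) :=
  ⟨splitForms cls κM K S, fun _ hP => exists_isHomogeneous_of_mem_splitForms cls κM hP,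
    coe_preimageSubgroup_eq_zeroLocus_of_split L cls κM K S hC⟩

/-! ### Consequence in a theta model: the closure of `Lie G'` -/

section Model

variable {N : ℕ} (M : AnalyticGroupModel (β ⊕ (γ ⊕ δ) → ℂ) N) (e : Option β × ThetaIdx γ δ ≃ Fin (N + 1))
variable (hΘ : ∀ J w, M.Θ (e J) w = theta L cls κM J w)
include hΘ

omit [DecidableEq 𝓙] in
/-- **If `exp⁻¹(G')` is `Θ`-definable, the closure `Z(𝔍(Lie G'))` of the Lie algebra lies in
`exp⁻¹(G')`** (indeed in any definable set containing `Lie G'`). [folklore] -/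
theorem zeroSet_vanishing_subset_of_thetaDefinable {X Y : Set (β ⊕ (γ ⊕ δ) → ℂ)}
    (hX : ThetaDefinable L cls κM X) (hYX : Y ⊆ X) :
    M.zeroSet ((M.vanishing Y : Ideal _) : Set (MvPolynomial (Fin (N + 1)) ℂ)) ⊆ X := by
  obtain ⟨Ps, hPs, rfl⟩ := hX
  intro w hw P hP
  obtain ⟨d, hd⟩ := hPs P hP
  exact thetaEval_eq_zero_of_mem_zeroSet L cls κM M e hΘ hd (fun x hx => hYX hx P hP) hw

/-- **For a split datum, `Z(𝔍(Lie G')) ⊆ Lie G' + ker`.** [folklore] -/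
theorem zeroSet_vanishing_tangent_subset_of_split (K : SubgroupDataC β γ δ cls κM) (S : Finset γ)
    (hC : K.C = coordSpan S) :
    M.zeroSet ((M.vanishing (K.tangent : Set (β ⊕ (γ ⊕ δ) → ℂ)) : Ideal _) :
        Set (MvPolynomial (Fin (N + 1)) ℂ)) ⊆ preimageSubgroup L cls κM K :=
  zeroSet_vanishing_subset_of_thetaDefinable L cls κM M e hΘ (thetaDefinable_preimageSubgroup_of_split L cls κM K S hC)
    fun _ hw => AddSubgroup.mem_sup_left hw

end Model

end Std

end GaGmEFam

end Literature.NumberTheory.Transcendental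

end
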